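import Literature.NumberTheory.LFunctions.TuringMethod
import Literature.NumberTheory.LFunctions.SimpleZeros
import Literature.NumberTheory.LFunctions.ZetaArgVariation
import HarnessLib

/-!
# Parity of the zero count of `ζ` on the critical line between two values of Hardy's `Z`

For `0 ≤ a ≤ b` with `Z(a) ≠ 0 ≠ Z(b)` (`Z = Literature.NumberTheory.LFunctions.hardyZ`), the number
`N₀(b) − N₀(a)` of zeros of `ζ` on the critical line with ordinate in `(a, b]`, counted with
multiplicity (`N₀ = Literature.NumberTheory.LFunctions.criticalZeroCount`), has the parity of the
sign of `Z(a) Z(b)`: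

  `(−1)^{N₀(a) + N₀(b)} Z(a) Z(b) > 0`     (`hardyZ_sign_parity`).

This is the exact form of "a sign change of `Z` between `a` and `b` is an odd number of zeros,
no sign change an even number" used with multiplicities (Edwards, *Riemann's Zeta Function*,
§6.5, §8.3; Titchmarsh §10.6; it is what makes Gram/Rosser-type zero counts honest when `Z`
happens to vanish at a sample point). The proof is the local structure of `Z` at a zero `t₀`:
`ζ(s) = (s − ρ₀)^m g(s)` near `ρ₀ = 1/2 + it₀` with `g(ρ₀) ≠ 0` (`m` = multiplicity), whence
`Z(t) = (t − t₀)^m h(t)` with `h` real, continuous and non-vanishing at `t₀`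
(`hardyZ_eq_pow_mul_eventually`), so `Z` changes sign at `t₀` iff `m` is odd; then induction on
the (finite) number of zeros in `(a, b)`.

Also recorded here (bookkeeping for the counting functions, all `[folklore]`):

* `intCast_criticalZeroCount` — `N₀` as the `finsum` of multiplicities it is defined to be, read
  in `ℤ` (the companion for `N` is `zetaZeroCount_eq_finsum`, `ZetaArgVariation.lean`);
* `zetaZeroCount_sub_criticalZeroCount_mono` — `N(T) − N₀(T)` (zeros off the line, with
  multiplicity) is non-decreasing, i.e. `N₀(b) − N₀(a) ≤ N(b) − N(a)` for `a ≤ b`;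
* `criticalZeroCount_eq_of_hardyZ_ne_zero` — no zero of `Z` in `(a, b]` ⇒ `N₀(b) = N₀(a)`;
* `intCast_criticalZeroCount_eq_add_of_unique_zero` — exactly one zero `t₀` of `Z` in `(a, b]` ⇒
  `N₀(b) = N₀(a) + m(1/2 + it₀)`;
* `setOf_hardyZ_eq_zero_finite` — the zeros of `Z` in a bounded interval `⊆ (0, ∞)` are finite.

These feed Lehman's argument that Rosser's rule fails infinitely often
(`Literature/Barriers/RiemannHypothesis/GramRosserFailuresLehmanProofs.lean`).

## References

* H. M. Edwards, *Riemann's Zeta Function*, Academic Press 1974, §6.5, §8.3.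
* E. C. Titchmarsh, *The Theory of the Riemann Zeta-Function*, 2nd ed. (1986), §9.1, §10.6.
* T. Trudgian, *On the success and failure of Gram's Law and the Rosser Rule*, Acta Arith. 148
  (2011) 225–256, §7.2–7.3 (where the parity bookkeeping is used implicitly).
-/

noncomputable section

open Complex Filter Set
open scoped Real Topology

namespace Literature.NumberTheory.LFunctions

/-! ### The counting functions as integer sums -/

/-- The set summed over by `N₀(T)` (critical zeros with `0 < Im ρ ≤ T`) is finite. [folklore] -/
theorem criticalZeroSet_finite (T : ℝ) :
    {ρ ∈ zetaZeroBox (1 / 2) T | ρ.re = 1 / 2}.Finite :=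
  (zetaZeroBox_finite _ _).subset (sep_subset _ _)

/-- `N₀(T)`, read in `ℤ`, is the sum of the multiplicities over the critical zeros with
`0 < Im ρ ≤ T` (the `toNat` in its definition is harmless: the sum is non-negative). [folklore] -/
theorem intCast_criticalZeroCount (T : ℝ) :
    (criticalZeroCount T : ℤ) =
      ∑ᶠ ρ ∈ {ρ ∈ zetaZeroBox (1 / 2) T | ρ.re = 1 / 2}, riemannZetaZeroOrder ρ := by
  unfold criticalZeroCount
  refine Int.toNat_of_nonneg ?_
  exact finsum_nonneg fun ρ ↦ finsum_nonneg fun hρ ↦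
    (DiophantineGeometry.riemannZetaZeroOrder_pos_of_mem_zetaZeroBox
      (DiophantineGeometry.criticalZeroSet_subset_zetaZeroBox T hρ)).le

/-- `N(T) − N₀(T)` is the sum of the multiplicities over the zeros *off* the critical line with
`0 < Im ρ ≤ T`. [folklore] -/
theorem intCast_zetaZeroCount_sub_criticalZeroCount (T : ℝ) :
    (zetaZeroCount T : ℤ) - criticalZeroCount T =
      ∑ᶠ ρ ∈ zetaZeroBox 0 T \ {ρ ∈ zetaZeroBox (1 / 2) T | ρ.re = 1 / 2},
        riemannZetaZeroOrder ρ := by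
  rw [zetaZeroCount_eq_finsum, intCast_criticalZeroCount]
  have hB := zetaZeroBox_finite 0 T
  have hC := criticalZeroSet_finite T
  have hsub := DiophantineGeometry.criticalZeroSet_subset_zetaZeroBox T
  conv_lhs => rw [← union_sdiff_cancel hsub]
  rw [finsum_mem_union disjoint_sdiff_right hC hB.sdiff]
  ring

/-- **The off-line zero count is monotone**: for `a ≤ b`,
`N(a) − N₀(a) ≤ N(b) − N₀(b)`, i.e. `N₀(b) − N₀(a) ≤ N(b) − N(a)` — the zeros on the line with
ordinate in `(a, b]` are among all zeros with ordinate in `(a, b]`. [folklore] -/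
theorem zetaZeroCount_sub_criticalZeroCount_mono {a b : ℝ} (hab : a ≤ b) :
    (zetaZeroCount a : ℤ) - criticalZeroCount a ≤ (zetaZeroCount b : ℤ) - criticalZeroCount b := by
  rw [intCast_zetaZeroCount_sub_criticalZeroCount, intCast_zetaZeroCount_sub_criticalZeroCount]
  have hB : (zetaZeroBox 0 b \ {ρ ∈ zetaZeroBox (1 / 2) b | ρ.re = 1 / 2}).Finite :=
    (zetaZeroBox_finite 0 b).sdiff
  have hsub : zetaZeroBox 0 a \ {ρ ∈ zetaZeroBox (1 / 2) a | ρ.re = 1 / 2} ⊆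
      zetaZeroBox 0 b \ {ρ ∈ zetaZeroBox (1 / 2) b | ρ.re = 1 / 2} := by
    rintro ρ ⟨⟨h0, h1, h2, h3, h4⟩, hnot⟩
    refine ⟨⟨h0, h1, h2, h3, h4.trans hab⟩, ?_⟩
    rintro ⟨⟨-, h1', -, -, -⟩, h5⟩
    exact hnot ⟨⟨h0, h1', h2, h3, h4⟩, h5⟩
  have hA := hB.subset hsub
  rw [finsum_mem_eq_finite_toFinset_sum _ hA, finsum_mem_eq_finite_toFinset_sum _ hB]
  refine Finset.sum_le_sum_of_subset_of_nonneg ((Finite.toFinset_subset_toFinset).2 hsub) ?_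
  intro ρ hρ _
  exact (DiophantineGeometry.riemannZetaZeroOrder_pos_of_mem_zetaZeroBox
    ((Finite.mem_toFinset hB).1 hρ).1).le

/-- The same in the form used for Gram blocks: `N₀(b) − N₀(a) ≤ N(b) − N(a)` (`a ≤ b`), in `ℤ`.
[folklore] -/
theorem criticalZeroCount_sub_le_zetaZeroCount_sub {a b : ℝ} (hab : a ≤ b) :
    (criticalZeroCount b : ℤ) - criticalZeroCount a ≤ (zetaZeroCount b : ℤ) - zetaZeroCount a := by
  have := zetaZeroCount_sub_criticalZeroCount_mono hab
  linarith

/-! ### Zeros of `Z` and the critical zero count on an interval -/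

/-- The point `1/2 + it` of the critical line. [folklore] -/
private theorem re_half_add (t : ℝ) : ((1 / 2 : ℂ) + t * I).re = 1 / 2 := by simp

/-- The point `1/2 + it` of the critical line. [folklore] -/
private theorem im_half_add (t : ℝ) : ((1 / 2 : ℂ) + t * I).im = t := by simp

/-- A point with `Re ρ = 1/2` is `1/2 + i Im ρ`. [folklore] -/
private theorem eq_half_add_of_re {ρ : ℂ} (h : ρ.re = 1 / 2) : (1 / 2 : ℂ) + (ρ.im : ℝ) * I = ρ := by
  apply Complex.ext
  · rw [re_half_add, h]
  · rw [im_half_add]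

/-- **No zero of `Z` in `(a, b]` ⇒ `N₀(b) = N₀(a)`** (`a ≤ b`): the zeros of `Z` are exactly the
critical zeros of `ζ` (`hardyZ_eq_zero_iff_holds`). [folklore] -/
theorem criticalZeroCount_eq_of_hardyZ_ne_zero {a b : ℝ} (hab : a ≤ b)
    (h : ∀ t, a < t → t ≤ b → hardyZ t ≠ 0) : criticalZeroCount b = criticalZeroCount a := by
  have hset : {ρ ∈ zetaZeroBox (1 / 2) b | ρ.re = 1 / 2} =
      {ρ ∈ zetaZeroBox (1 / 2) a | ρ.re = 1 / 2} := by
    ext ρ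
    constructor
    · rintro ⟨⟨h0, h1, h2, h3, h4⟩, h5⟩
      refine ⟨⟨h0, h1, h2, h3, ?_⟩, h5⟩
      by_contra hlt
      push Not at hlt
      refine h ρ.im hlt h4 ?_
      rw [hardyZ_eq_zero_iff_holds, eq_half_add_of_re h5]
      exact h0
    · rintro ⟨⟨h0, h1, h2, h3, h4⟩, h5⟩
      exact ⟨⟨h0, h1, h2, h3, h4.trans hab⟩, h5⟩
  unfold criticalZeroCount
  rw [hset]

/-- **Exactly one zero `t₀` of `Z` in `(a, b]` ⇒ `N₀(b) = N₀(a) + m(1/2 + it₀)`** (`0 ≤ a < t₀ ≤ b`).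
[folklore] -/
theorem intCast_criticalZeroCount_eq_add_of_unique_zero {a b t₀ : ℝ} (ha : 0 ≤ a) (hat : a < t₀)
    (htb : t₀ ≤ b) (hz : hardyZ t₀ = 0) (h : ∀ t, a < t → t ≤ b → t ≠ t₀ → hardyZ t ≠ 0) :
    (criticalZeroCount b : ℤ) = criticalZeroCount a + riemannZetaZeroOrder (1 / 2 + t₀ * I) := by
  set ρ₀ : ℂ := 1 / 2 + t₀ * I with hρ₀
  have hζ : riemannZeta ρ₀ = 0 := (hardyZ_eq_zero_iff_holds t₀).1 hz
  have hρ₀mem : ρ₀ ∈ {ρ ∈ zetaZeroBox (1 / 2) b | ρ.re = 1 / 2} := by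
    refine ⟨⟨hζ, ?_, ?_, ?_, ?_⟩, re_half_add t₀⟩
    · rw [re_half_add]
    · rw [re_half_add]; norm_num
    · rw [im_half_add]; linarith
    · rw [im_half_add]; exact htb
  have hρ₀not : ρ₀ ∉ {ρ ∈ zetaZeroBox (1 / 2) a | ρ.re = 1 / 2} := by
    rintro ⟨⟨-, -, -, -, h4⟩, -⟩
    rw [im_half_add] at h4
    linarith
  have hset : {ρ ∈ zetaZeroBox (1 / 2) b | ρ.re = 1 / 2} =
      {ρ ∈ zetaZeroBox (1 / 2) a | ρ.re = 1 / 2} ∪ {ρ₀} := by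
    ext ρ
    constructor
    · rintro ⟨⟨h0, h1, h2, h3, h4⟩, h5⟩
      by_cases hle : ρ.im ≤ a
      · exact Or.inl ⟨⟨h0, h1, h2, h3, hle⟩, h5⟩
      · push Not at hle
        by_cases heq : ρ.im = t₀
        · right
          rw [mem_singleton_iff, ← eq_half_add_of_re h5, heq]
        · exfalso
          refine h ρ.im hle h4 heq ?_
          rw [hardyZ_eq_zero_iff_holds, eq_half_add_of_re h5]
          exact h0
    · rintro (⟨⟨h0, h1, h2, h3, h4⟩, h5⟩ | hmem)
      · exact ⟨⟨h0, h1, h2, h3, h4.trans (hat.le.trans htb)⟩, h5⟩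
      · rw [mem_singleton_iff] at hmem
        rw [hmem]
        exact hρ₀mem
  rw [intCast_criticalZeroCount, intCast_criticalZeroCount, hset,
    finsum_mem_union (disjoint_singleton_right.2 hρ₀not) (criticalZeroSet_finite a)
      (finite_singleton _), finsum_mem_singleton]

/-- The zeros of `Z` in an interval `(a, b)` with `a ≥ 0` form a finite set (they inject into the
finite box of zeros of `ζ` with `1/2 ≤ Re ρ ≤ 1`, `0 < Im ρ ≤ b`). [folklore] -/
theorem setOf_hardyZ_eq_zero_finite {a : ℝ} (b : ℝ) (ha : 0 ≤ a) :
    {t : ℝ | a < t ∧ t < b ∧ hardyZ t = 0}.Finite := by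
  have hfin := zetaZeroBox_finite (1 / 2) b
  have hinj : Set.InjOn (fun t : ℝ ↦ (1 / 2 : ℂ) + t * I)
      ((fun t : ℝ ↦ (1 / 2 : ℂ) + t * I) ⁻¹' zetaZeroBox (1 / 2) b) := by
    intro x _ y _ hxy
    have := congrArg Complex.im hxy
    simpa using this
  refine (hfin.preimage hinj).subset ?_
  rintro t ⟨hat, htb, hz0⟩
  refine ⟨(hardyZ_eq_zero_iff_holds t).1 hz0, ?_, ?_, ?_, ?_⟩
  · rw [re_half_add]
  · rw [re_half_add]; norm_num
  · rw [im_half_add]; linarith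
  · rw [im_half_add]; exact htb.le

/-! ### Local structure of `Z` at a point -/

/-- **Local structure of `Z`.** For every real `t₀` there are `m ∈ ℕ` — the multiplicity
`m(1/2 + it₀)` of `1/2 + it₀` as a zero of `ζ` (`0` if it is not a zero) — and a real function `h`,
continuous and non-zero at `t₀`, with `Z(t) = (t − t₀)^m h(t)` for `t` near `t₀`. (From
`ζ(s) = (s − ρ₀)^m g(s)`, `g(ρ₀) ≠ 0`, and `Z(t) = e^{iθ(t)} ζ(1/2 + it)` real: `h` is the real part
of `i^m e^{iθ(t)} g(1/2 + it)`, whose imaginary part vanishes near `t₀` by reality of `Z` and at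
`t₀` by continuity.) [folklore] -/
theorem hardyZ_eq_pow_mul_eventually (t₀ : ℝ) :
    ∃ (m : ℕ) (h : ℝ → ℝ), riemannZetaZeroOrder (1 / 2 + t₀ * I) = m ∧ ContinuousAt h t₀ ∧
      h t₀ ≠ 0 ∧ ∀ᶠ t in 𝓝 t₀, hardyZ t = (t - t₀) ^ m * h t := by
  set ρ₀ : ℂ := 1 / 2 + t₀ * I with hρ₀
  have hne1 : ρ₀ ≠ 1 := by
    intro h
    have := congrArg Complex.re h
    rw [re_half_add] at this
    norm_num at this
  have ha : AnalyticAt ℂ riemannZeta ρ₀ := analyticOn_riemannZeta ρ₀ hne1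
  obtain ⟨m, hm⟩ := ENat.ne_top_iff_exists.mp (analyticOrderAt_riemannZeta_ne_top hne1)
  obtain ⟨g, hg_an, hg_ne, hg_eq⟩ := ha.analyticOrderAt_eq_natCast.1 hm.symm
  -- the line `t ↦ 1/2 + it`
  set ℓ : ℝ → ℂ := fun t ↦ 1 / 2 + t * I with hℓ
  have hℓ_cont : Continuous ℓ := by
    simp only [hℓ]
    fun_prop
  have hℓt₀ : ℓ t₀ = ρ₀ := rfl
  have hℓ_tend : Tendsto ℓ (𝓝 t₀) (𝓝 ρ₀) := hℓt₀ ▸ hℓ_cont.continuousAt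
  have hev : ∀ᶠ t in 𝓝 t₀, riemannZeta (ℓ t) = (ℓ t - ρ₀) ^ m * g (ℓ t) := by
    filter_upwards [hℓ_tend.eventually hg_eq] with t ht
    simpa [smul_eq_mul] using ht
  -- the complex cofactor
  set G : ℝ → ℂ := fun t ↦ I ^ m * cexp (riemannSiegelTheta t * I) * g (ℓ t) with hG
  have hG_cont : ContinuousAt G t₀ := by
    have h1 : Continuous fun t : ℝ ↦ cexp (riemannSiegelTheta t * I) :=
      Complex.continuous_exp.comp
        ((Complex.continuous_ofReal.comp continuous_riemannSiegelTheta).mul continuous_const)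
    have h2 : ContinuousAt (fun t ↦ g (ℓ t)) t₀ :=
      ContinuousAt.comp (hℓt₀ ▸ hg_an.continuousAt) hℓ_cont.continuousAt
    exact (continuousAt_const.mul h1.continuousAt).mul h2
  have hG_ne : G t₀ ≠ 0 :=
    mul_ne_zero (mul_ne_zero (pow_ne_zero _ I_ne_zero) (Complex.exp_ne_zero _)) hg_ne
  -- `(Z t : ℂ) = (t - t₀)^m G t` near `t₀`
  have hZC : ∀ᶠ t in 𝓝 t₀, (hardyZ t : ℂ) = ((t - t₀ : ℝ) : ℂ) ^ m * G t := by
    filter_upwards [hev] with t ht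
    rw [ofReal_hardyZ_holds t]
    change cexp (riemannSiegelTheta t * I) * riemannZeta (ℓ t) = _
    rw [ht]
    have e : ℓ t - ρ₀ = ((t - t₀ : ℝ) : ℂ) * I := by
      simp only [hℓ, hρ₀]
      push_cast
      ring
    rw [e, mul_pow, hG]
    ring
  -- `Im G = 0` on a punctured neighbourhood, hence at `t₀`
  have hIm_ev : ∀ᶠ t in 𝓝[≠] t₀, (G t).im = 0 := by
    have h1 : ∀ᶠ t in 𝓝[≠] t₀, (hardyZ t : ℂ) = ((t - t₀ : ℝ) : ℂ) ^ m * G t :=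
      hZC.filter_mono nhdsWithin_le_nhds
    have h2 : ∀ᶠ t in 𝓝[≠] t₀, t ≠ t₀ := eventually_nhdsWithin_of_forall fun t ht ↦ ht
    filter_upwards [h1, h2] with t ht hne
    have him := congrArg Complex.im ht
    rw [Complex.ofReal_im, ← Complex.ofReal_pow, Complex.im_ofReal_mul] at him
    have hpow : (t - t₀) ^ m ≠ 0 := pow_ne_zero _ (sub_ne_zero.2 hne)
    exact (mul_eq_zero.1 him.symm).resolve_left hpow
  have hIm0 : (G t₀).im = 0 := by
    have hc : Tendsto (fun t ↦ (G t).im) (𝓝[≠] t₀) (𝓝 (G t₀).im) :=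
      ((Complex.continuous_im.continuousAt.comp hG_cont).tendsto).mono_left nhdsWithin_le_nhds
    have hc0 : Tendsto (fun t ↦ (G t).im) (𝓝[≠] t₀) (𝓝 0) :=
      tendsto_const_nhds.congr' (hIm_ev.mono fun t ht ↦ ht.symm)
    exact tendsto_nhds_unique hc hc0
  refine ⟨m, fun t ↦ (G t).re, ?_, Complex.continuous_re.continuousAt.comp hG_cont, ?_, ?_⟩
  · have := riemannZetaZeroOrder_eq_analyticOrderAt hne1
    rw [← hm, ENat.map_coe] at this
    exact_mod_cast this
  · intro hre
    exact hG_ne (Complex.ext (by simpa using hre) (by simpa using hIm0))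
  · filter_upwards [hZC] with t ht
    have := congrArg Complex.re ht
    rwa [Complex.ofReal_re, ← Complex.ofReal_pow, Complex.re_ofReal_mul] at this

/-! ### The parity lemma -/

/-- No zero of `Z` on `[a, b]` (`a ≤ b`): `Z(a) Z(b) > 0` (intermediate value theorem) and
`N₀(b) = N₀(a)`, so `(−1)^{N₀(a)+N₀(b)} Z(a) Z(b) > 0`. [folklore] -/
theorem hardyZ_sign_parity_of_forall_ne_zero {a b : ℝ} (hab : a ≤ b)
    (h : ∀ t ∈ Icc a b, hardyZ t ≠ 0) :
    0 < (-1 : ℝ) ^ (criticalZeroCount a + criticalZeroCount b) * (hardyZ a * hardyZ b) := by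
  have hN : criticalZeroCount b = criticalZeroCount a :=
    criticalZeroCount_eq_of_hardyZ_ne_zero hab fun t hat htb ↦ h t ⟨hat.le, htb⟩
  rw [hN, ← two_mul, pow_mul, neg_one_sq, one_pow, one_mul]
  by_contra hle
  push Not at hle
  have hlt : hardyZ a * hardyZ b < 0 :=
    lt_of_le_of_ne hle (mul_ne_zero (h a ⟨le_rfl, hab⟩) (h b ⟨hab, le_rfl⟩))
  have h0 : (0 : ℝ) ∈ uIcc (hardyZ a) (hardyZ b) := by
    rcases mul_neg_iff.1 hlt with ⟨h1, h2⟩ | ⟨h1, h2⟩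
    · exact mem_uIcc.2 (Or.inr ⟨h2.le, h1.le⟩)
    · exact mem_uIcc.2 (Or.inl ⟨h1.le, h2.le⟩)
  obtain ⟨c, hc, hc0⟩ := intermediate_value_uIcc continuous_hardyZ.continuousOn h0
  rw [uIcc_of_le hab] at hc
  exact h c hc hc0

/-- **The local step at a zero.** If `Z(t₀) = 0` (`t₀ > 0`) and `U` is a neighbourhood of `t₀`,
there is `δ > 0` with `[t₀ − δ, t₀ + δ] ⊆ U`, `t₀ − δ ≥ 0`, no other zero of `Z` on
`[t₀ − δ, t₀ + δ]`, and `(−1)^{N₀(t₀−δ) + N₀(t₀+δ)} Z(t₀ − δ) Z(t₀ + δ) > 0` (both sides have the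
parity of the multiplicity `m`: `N₀(t₀+δ) = N₀(t₀−δ) + m` and
`Z(t₀ ± δ) = (±δ)^m h(t₀ ± δ)` with `h(t₀ − δ) h(t₀ + δ) > 0`). [folklore] -/
theorem hardyZ_sign_parity_local_step {t₀ : ℝ} (ht₀ : 0 < t₀) (hz : hardyZ t₀ = 0) {U : Set ℝ}
    (hU : U ∈ 𝓝 t₀) :
    ∃ δ : ℝ, 0 < δ ∧ δ < t₀ ∧ Icc (t₀ - δ) (t₀ + δ) ⊆ U ∧
      (∀ t ∈ Icc (t₀ - δ) (t₀ + δ), t ≠ t₀ → hardyZ t ≠ 0) ∧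
      0 < (-1 : ℝ) ^ (criticalZeroCount (t₀ - δ) + criticalZeroCount (t₀ + δ)) *
        (hardyZ (t₀ - δ) * hardyZ (t₀ + δ)) := by
  obtain ⟨m, h, hord, hcont, hne, hfact⟩ := hardyZ_eq_pow_mul_eventually t₀
  -- `h` keeps the sign of `h t₀` near `t₀`
  have hsign : ∀ᶠ t in 𝓝 t₀, 0 < h t₀ * h t :=
    ContinuousAt.eventually_lt continuousAt_const (continuousAt_const.mul hcont)
      (by simpa using mul_self_pos.2 hne)
  obtain ⟨ε, hε, hball⟩ := Metric.mem_nhds_iff.1 (inter_mem hU (inter_mem hsign hfact))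
  set δ : ℝ := min (ε / 2) (t₀ / 2) with hδ_def
  have hδ : 0 < δ := lt_min (by linarith) (by linarith)
  have hδt : δ < t₀ := (min_le_right _ _).trans_lt (by linarith)
  have hδε : δ < ε := (min_le_left _ _).trans_lt (by linarith)
  have hIcc : Icc (t₀ - δ) (t₀ + δ) ⊆ U ∩ ({t | 0 < h t₀ * h t} ∩ {t | hardyZ t = (t - t₀) ^ m * h t}) := by
    intro t ht
    apply hball
    rw [Metric.mem_ball, Real.dist_eq, abs_lt]
    constructor <;> linarith [ht.1, ht.2]
  have hmemL : t₀ - δ ∈ Icc (t₀ - δ) (t₀ + δ) := ⟨le_rfl, by linarith⟩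
  have hmemR : t₀ + δ ∈ Icc (t₀ - δ) (t₀ + δ) := ⟨by linarith, le_rfl⟩
  -- no other zeros on the closed interval
  have hnoz : ∀ t ∈ Icc (t₀ - δ) (t₀ + δ), t ≠ t₀ → hardyZ t ≠ 0 := by
    intro t ht htne
    obtain ⟨-, hs, hf⟩ := hIcc ht
    rw [mem_setOf_eq] at hs hf
    rw [hf]
    refine mul_ne_zero (pow_ne_zero _ (sub_ne_zero.2 htne)) ?_
    rintro h0
    rw [h0, mul_zero] at hs
    exact lt_irrefl _ hs
  refine ⟨δ, hδ, hδt, fun t ht ↦ (hIcc ht).1, hnoz, ?_⟩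
  -- the count: `N₀(t₀ + δ) = N₀(t₀ - δ) + m`
  have hcount : criticalZeroCount (t₀ + δ) = criticalZeroCount (t₀ - δ) + m := by
    have hint := intCast_criticalZeroCount_eq_add_of_unique_zero (a := t₀ - δ) (b := t₀ + δ)
      (t₀ := t₀) (by linarith) (by linarith) (by linarith) hz
      (fun t hat htb htne ↦ hnoz t ⟨hat.le, htb⟩ htne)
    rw [hord] at hint
    exact_mod_cast hint
  -- the values at the endpoints
  obtain ⟨-, hsL, hfL⟩ := hIcc hmemL
  obtain ⟨-, hsR, hfR⟩ := hIcc hmemR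
  rw [mem_setOf_eq] at hsL hsR hfL hfR
  have hprod : 0 < h (t₀ - δ) * h (t₀ + δ) := by
    have := mul_pos hsL hsR
    have e : h t₀ * h (t₀ - δ) * (h t₀ * h (t₀ + δ)) =
        (h (t₀ - δ) * h (t₀ + δ)) * (h t₀ * h t₀) := by ring
    rw [e] at this
    exact (mul_pos_iff_of_pos_right (mul_self_pos.2 hne)).1 this
  rw [hcount, hfL, hfR, show t₀ - δ - t₀ = -δ by ring, show t₀ + δ - t₀ = δ by ring, neg_pow δ m]
  have hone : (-1 : ℝ) ^ (criticalZeroCount (t₀ - δ) + (criticalZeroCount (t₀ - δ) + m)) *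
      (-1) ^ m = 1 := by
    rw [← pow_add, show criticalZeroCount (t₀ - δ) + (criticalZeroCount (t₀ - δ) + m) + m =
      2 * (criticalZeroCount (t₀ - δ) + m) by ring, pow_mul, neg_one_sq, one_pow]
  have e : (-1 : ℝ) ^ (criticalZeroCount (t₀ - δ) + (criticalZeroCount (t₀ - δ) + m)) *
      ((-1) ^ m * δ ^ m * h (t₀ - δ) * (δ ^ m * h (t₀ + δ))) =
      ((-1 : ℝ) ^ (criticalZeroCount (t₀ - δ) + (criticalZeroCount (t₀ - δ) + m)) * (-1) ^ m) *
        (δ ^ m * δ ^ m * (h (t₀ - δ) * h (t₀ + δ))) := by ring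
  rw [e, hone, one_mul]
  exact mul_pos (mul_pos (pow_pos hδ m) (pow_pos hδ m)) hprod

/-- The parity lemma, by induction on a bound `n` for the number of zeros of `Z` in `(a, b)`.
[folklore] -/
theorem hardyZ_sign_parity_aux (n : ℕ) :
    ∀ {a b : ℝ}, 0 ≤ a → a ≤ b → hardyZ a ≠ 0 → hardyZ b ≠ 0 →
      {t : ℝ | a < t ∧ t < b ∧ hardyZ t = 0}.ncard ≤ n →
      0 < (-1 : ℝ) ^ (criticalZeroCount a + criticalZeroCount b) * (hardyZ a * hardyZ b) := by
  induction n with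
  | zero =>
    intro a b ha hab hZa hZb hcard
    have hfin := setOf_hardyZ_eq_zero_finite b ha
    have hempty : {t : ℝ | a < t ∧ t < b ∧ hardyZ t = 0} = ∅ :=
      (ncard_eq_zero hfin).1 (Nat.le_zero.1 hcard)
    refine hardyZ_sign_parity_of_forall_ne_zero hab fun t ht hz ↦ ?_
    rcases ht.1.eq_or_lt with rfl | hat
    · exact hZa hz
    rcases ht.2.eq_or_lt with rfl | htb
    · exact hZb hz
    have : t ∈ ({t : ℝ | a < t ∧ t < b ∧ hardyZ t = 0} : Set ℝ) := ⟨hat, htb, hz⟩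
    rw [hempty] at this
    exact this
  | succ n ih =>
    intro a b ha hab hZa hZb hcard
    set E : Set ℝ := {t : ℝ | a < t ∧ t < b ∧ hardyZ t = 0} with hE
    have hfin : E.Finite := setOf_hardyZ_eq_zero_finite b ha
    rcases E.eq_empty_or_nonempty with hempty | hne
    · refine hardyZ_sign_parity_of_forall_ne_zero hab fun t ht hz ↦ ?_
      rcases ht.1.eq_or_lt with rfl | hat
      · exact hZa hz
      rcases ht.2.eq_or_lt with rfl | htb
      · exact hZb hz
      have : t ∈ E := ⟨hat, htb, hz⟩
      rw [hempty] at this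
      exact this
    -- the smallest zero in `(a, b)`
    obtain ⟨t₀, ⟨hat₀, ht₀b, hz₀⟩, hmin⟩ := E.exists_min_image id hfin hne
    have ht₀ : 0 < t₀ := ha.trans_lt hat₀
    obtain ⟨δ, hδ, -, hsub, hnoz, hmid⟩ :=
      hardyZ_sign_parity_local_step ht₀ hz₀ (Ioo_mem_nhds hat₀ ht₀b)
    have hL : a < t₀ - δ := (hsub ⟨le_rfl, by linarith⟩).1
    have hR : t₀ + δ < b := (hsub ⟨by linarith, le_rfl⟩).2
    have hZL : hardyZ (t₀ - δ) ≠ 0 := hnoz _ ⟨le_rfl, by linarith⟩ (by linarith)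
    have hZR : hardyZ (t₀ + δ) ≠ 0 := hnoz _ ⟨by linarith, le_rfl⟩ (by linarith)
    -- left piece: no zeros on `[a, t₀ - δ]`
    have hleft : 0 < (-1 : ℝ) ^ (criticalZeroCount a + criticalZeroCount (t₀ - δ)) *
        (hardyZ a * hardyZ (t₀ - δ)) := by
      refine hardyZ_sign_parity_of_forall_ne_zero hL.le fun t ht hz ↦ ?_
      rcases ht.1.eq_or_lt with rfl | hat
      · exact hZa hz
      have htE : t ∈ E := ⟨hat, by linarith [ht.2], hz⟩
      have := hmin t htE
      simp only [id_eq] at this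
      linarith [ht.2]
    -- right piece: induction hypothesis on `[t₀ + δ, b]`
    have hright : 0 < (-1 : ℝ) ^ (criticalZeroCount (t₀ + δ) + criticalZeroCount b) *
        (hardyZ (t₀ + δ) * hardyZ b) := by
      refine ih (by linarith) hR.le hZR hZb ?_
      have hsubE : {t : ℝ | t₀ + δ < t ∧ t < b ∧ hardyZ t = 0} ⊆ E \ {t₀} := by
        rintro t ⟨h1, h2, h3⟩
        refine ⟨⟨by linarith, h2, h3⟩, ?_⟩
        rw [mem_singleton_iff]
        intro h
        rw [h] at h1
        linarith
      have h1 := ncard_le_ncard hsubE hfin.sdiff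
      rw [ncard_sdiff_singleton_of_mem (show t₀ ∈ E from ⟨hat₀, ht₀b, hz₀⟩)] at h1
      omega
    -- combine
    have hprod := mul_pos (mul_pos hleft hmid) hright
    have e : (-1 : ℝ) ^ (criticalZeroCount a + criticalZeroCount (t₀ - δ)) *
          (hardyZ a * hardyZ (t₀ - δ)) *
        ((-1) ^ (criticalZeroCount (t₀ - δ) + criticalZeroCount (t₀ + δ)) *
          (hardyZ (t₀ - δ) * hardyZ (t₀ + δ))) *
        ((-1) ^ (criticalZeroCount (t₀ + δ) + criticalZeroCount b) *
          (hardyZ (t₀ + δ) * hardyZ b)) =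
        (-1 : ℝ) ^ (criticalZeroCount a + criticalZeroCount b) * (hardyZ a * hardyZ b) *
          (((-1) ^ (criticalZeroCount (t₀ - δ) + criticalZeroCount (t₀ + δ))) ^ 2 *
            (hardyZ (t₀ - δ) * hardyZ (t₀ + δ)) ^ 2) := by
      ring
    rw [e] at hprod
    have hsq : 0 < ((-1 : ℝ) ^ (criticalZeroCount (t₀ - δ) + criticalZeroCount (t₀ + δ))) ^ 2 *
        (hardyZ (t₀ - δ) * hardyZ (t₀ + δ)) ^ 2 :=
      mul_pos (sq_pos_of_ne_zero (pow_ne_zero _ (by norm_num)))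
        (sq_pos_of_ne_zero (mul_ne_zero hZL hZR))
    exact (mul_pos_iff_of_pos_right hsq).1 hprod

/-- **Parity lemma for Hardy's function.** For `0 ≤ a ≤ b` with `Z(a) ≠ 0` and `Z(b) ≠ 0`,
`(−1)^{N₀(a) + N₀(b)} Z(a) Z(b) > 0`: the number of zeros of `ζ` on the critical line with
ordinate in `(a, b]`, counted with multiplicity, is even iff `Z(a)` and `Z(b)` have the same sign
(Edwards §6.5, §8.3: a sign change of `Z` detects an odd number of zeros). [folklore] -/
theorem hardyZ_sign_parity {a b : ℝ} (ha : 0 ≤ a) (hab : a ≤ b) (hZa : hardyZ a ≠ 0)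
    (hZb : hardyZ b ≠ 0) :
    0 < (-1 : ℝ) ^ (criticalZeroCount a + criticalZeroCount b) * (hardyZ a * hardyZ b) :=
  hardyZ_sign_parity_aux _ ha hab hZa hZb le_rfl

/-- `(−1)^n x > 0` with `x > 0` forces `n` even. [folklore] -/
theorem even_of_neg_one_pow_mul_pos {n : ℕ} {x : ℝ} (hx : 0 < x) (h : 0 < (-1 : ℝ) ^ n * x) :
    Even n := by
  rcases Nat.even_or_odd n with hn | hn
  · exact hn
  · rw [hn.neg_one_pow] at h
    linarith

/-- `(−1)^n x > 0` with `x < 0` forces `n` odd. [folklore] -/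
theorem odd_of_neg_one_pow_mul_pos {n : ℕ} {x : ℝ} (hx : x < 0) (h : 0 < (-1 : ℝ) ^ n * x) :
    Odd n := by
  rcases Nat.even_or_odd n with hn | hn
  · rw [hn.neg_one_pow] at h
    linarith
  · exact hn

/-- Parity lemma, `Even` form: for `0 ≤ a ≤ b` with `Z(a) Z(b) > 0`, `N₀(a) + N₀(b)` is even.
[folklore] -/
theorem even_criticalZeroCount_add_of_hardyZ_mul_pos {a b : ℝ} (ha : 0 ≤ a) (hab : a ≤ b)
    (h : 0 < hardyZ a * hardyZ b) : Even (criticalZeroCount a + criticalZeroCount b) := by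
  have hZa : hardyZ a ≠ 0 := fun h0 ↦ by simp [h0] at h
  have hZb : hardyZ b ≠ 0 := fun h0 ↦ by simp [h0] at h
  exact even_of_neg_one_pow_mul_pos h (hardyZ_sign_parity ha hab hZa hZb)

/-- Parity lemma, `Odd` form: for `0 ≤ a ≤ b` with `Z(a) Z(b) < 0`, `N₀(a) + N₀(b)` is odd (in
particular `N₀(b) > N₀(a)`: a sign change detects a zero). [folklore] -/
theorem odd_criticalZeroCount_add_of_hardyZ_mul_neg {a b : ℝ} (ha : 0 ≤ a) (hab : a ≤ b)
    (h : hardyZ a * hardyZ b < 0) : Odd (criticalZeroCount a + criticalZeroCount b) := by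
  have hZa : hardyZ a ≠ 0 := fun h0 ↦ by simp [h0] at h
  have hZb : hardyZ b ≠ 0 := fun h0 ↦ by simp [h0] at h
  exact odd_of_neg_one_pow_mul_pos h (hardyZ_sign_parity ha hab hZa hZb)

end Literature.NumberTheory.LFunctions
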